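/-
Copyright: lit-balaban cell, Phase-2 proof seat p33 (gen 6).  Statement-level skeleton of a published paper; no proof claims beyond
what the kernel checks below.
-/
import Literature.MathematicalPhysics.QuantumFieldTheory.BalabanImbrieJaffe1984to88.BIJ85Ineq732BackgroundRate

/-!
# `BalabanImbrieJaffe1984to88.BIJ85Claim73Background` — T. Bałaban, J. Imbrie, A. Jaffe, *Renormalization of the Higgs model:
minimizers, propagators and the stability of mean field theory*, Commun. Math. Phys. **97** (1985) 299–329
[BalabanImbrieJaffe1985]: **(7.3.1) ⇒ (7.3.2)** p. 326 for the background (4.5.4) `u_k = Q^{s*}_kv·exp[−ie_kη(𝒟_k∂^*Q^{e*}_kf^{(k)})]`,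
`f^{(k)}(p) = (ie_k)^{−1} ln v(∂p)` ((4.2.4)), COMPOSED: the hypothesis (7.3.1) `|v(∂p) − 1| ≤ e_k𝓅(e_k)` on the unit-lattice field `v` IS
USED — it bounds `|f^{(k)}| ≤ (π/2)𝓅(e_k)` — and the smoothing operator `𝒪 = 𝒟_k∂^*Q^{e*}_k` enters only through the located sup-norm property
`|(𝒪g)_b| ≤ K_D·max|g|` (p. 326: *"The operators 𝒟_k have the same properties as the operators G_k in [6I], Proposition 1.2"*; row
C1.Eq7.2.4's remark, not kernelled), carried by the index together with the small-coupling condition; the conclusion is r15's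
`ScalarStabData.Claim73` for the family of ACTUAL Sect. 7.3 data (background computed from `v`), `γ = min(a/(10d), ⅕)`, `α = 1`,
`M = 32γd(2d+1)²((π/2)K_D(1+2p)^p)²` (file 8 of this seat's member of SKELETON row **C1.Eq7.3.1-7.3.2**; over file 6 `BIJ85Ineq732BackgroundRate`
p266096 and file 5 `BIJ85Ineq732BackgroundStab` p265577; requested by the row's owner r15, seat INBOX 2026-08-21T11:45:57Z).

statement-level skeleton of published theorems with citation tags; proofs where landed; nothing here is a claim about the Yang–Mills mass gap

PDF held: `paper:balaban1985-cmp97-bij-higgs-minimizers` (journal page = PDF page + 298).  Pages read (`lit read`, OCR text): p. 310 [PDF 12]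
((4.2.4)), p. 313 [PDF 15] ((4.5.4)), p. 326 [PDF 28] ((7.2.4) remark, (7.3.1)–(7.3.2)).

CITATION HEADER (lean-in-tree rule).  Phase-2 file of the lit-balaban TYPED SKELETON (HOME `run/shared/lean/pub/lit-balaban/`), seat p33 gen 6
(unit `lit-balaban-p33-g6`; TAKING line HOME/STATUS.md 2026-08-21T10:38:53Z; owner r15, referee ref-5; GAPS G-C1-05).  Objects BY NAME:
`BIJ88Sect3Statements.plaqVar`/`cfg` (`v(∂p)`), file 4's `bg454`, file 5's `BgIdx`/`bgStabData`/`ineq732_bgStabData`, file 6's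
`BgIdxP.toBgIdx`, r15's `ScalarStabData`.  Definitions with bodies: `fK` ((4.2.4)), `thetaK` (the phase of (4.5.4) for an operator `𝒪`),
the index `ActIdx`, its Sect. 7.3 datum `actStabData` and the map `ActIdx.toBgIdxP`; no instance beyond the structure, no named fact.

THE PRINTED TEXT, verbatim.  p. 310 [PDF 12]: *"f^{(k)} = (ie_k)^{−1} ln v(∂p), p ∈ T₁^{(k)}, (4.2.4)"*; p. 313 [PDF 15]: *"(u_k)_b =
(Q^{s*}_kv)_b exp[−ie_kη(𝒟_k∂^*Q^{e*}_kf^{(k)})_b]. (4.5.4)"*; p. 326 [PDF 28]: *"The operators 𝒟_k have the same properties as the operators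
G_k in [6I], Proposition 1.2, with exponential decay but singularities on the diagonal. … let us assume that for the unit lattice field v,
|v(∂p) − 1| ≤ e_k𝓅(e_k), (7.3.1) where 𝓅(e_k) = (1 + ln e_k^{−1})^p. Then … For constants γ > 0, α > 0, M < ∞, ⟨φ, Δ_k(u_k)φ⟩ ≥
γ Σ_{b∈T₁^{(k)}} |u_k(b)φ(b₊) − φ(b₋)|² − Me_k^{2−α} Σ_{x∈T₁^{(k)}} |φ(x)|². (7.3.2)"*

WHAT IS PROVED (0 `sorry`, standard axioms).
* §1 `abs_arg_le_of_norm_eq_one` — for `|z| = 1`: `|arg z| ≤ (π/2)|z − 1|` (`|z − 1| = 2|sin(arg z/2)|` and Jordan's inequality).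
* §2 `fK e v p := arg(v(∂p))/e` = (4.2.4) in the branch (2.11); **(7.3.1) ⇒ `|f^{(k)}(p)| ≤ (π/2)𝓅(e_k)`** (`abs_fK_le_of_hyp731`).
* §3 the phase of (4.5.4) for a smoothing operator `𝒪` (unit-lattice plaquette fields → `η`-bond fields): `thetaK k e 𝒪 v := b ↦ −(e/L^k)·(𝒪(fK e v))_b`
  (`η = L^{−k}`); under (7.3.1) and `|(𝒪g)_b| ≤ K_D·C` whenever `|g| ≤ C`: `L^k·|θ_b| ≤ (π/2)K_D·e_k𝓅(e_k)` (`pow_mul_abs_thetaK_le`).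
* §4 **`claim73_actual`** — r15's `ScalarStabData.Claim73 p (actStabData a ha)` over `ActIdx d K_D p` = (torus, `k ≥ 1`, `0 < e_k ≤ 1` with
  `36d(2d+1)²((π/2)K_De_k𝓅(e_k))² ≤ 1`, ANY unit-lattice `U(1)` field `v`, any operator `𝒪` with the sup-norm property at constant `K_D`), the
  datum being the Sect. 7.3 data AT THE BACKGROUND `Q^{s*}_kv·e^{iθ}`, `θ = −e_kη·𝒪f^{(k)}` COMPUTED FROM `v`: **`Hyp731 → Ineq732 γ 1 M`** with
  `γ = min(a/(10d), ⅕)`, `M = 32γd(2d+1)²((π/2)K_D(1+2p)^p)²`, the hypothesis (7.3.1) being USED (through §2–§3 and file 6's rate).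
HONEST SCOPE.  `𝒪` is abstract: instantiating it with the torus `𝒟_k∂^*Q^{e*}_k` of record (`BIJ85Prop522Torus.DkE`, `curlOp`, `QesOp` at `j = 0`)
and DISCHARGING its sup-norm property is row C1.Eq7.2.4's remark / [6I] Prop. 1.2 for `𝒟_k` — not proved here.  Nothing printed is
contradicted or weakened.
-/

open scoped RealInnerProductSpace BigOperators
open Finset

namespace Literature.MathematicalPhysics.QuantumFieldTheory.BalabanImbrieJaffe1984to88.BIJ85Claim73Background

open Literature.MathematicalPhysics.QuantumFieldTheory.Balaban1983to89
open BIJ88Sect3Statements (U1 toC cfg plaqVar plaqVar_cfg norm_toC toC_one)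
open BIJ85BlockAveragesTorusK BIJ85ScalarPropagatorTorus BIJ85ScalarPropagatorTorusK BIJ85ScalarForm464
open BIJ85Ineq732Flat (FlatIdx cPhys cPhys_pos)
open BIJ85Ineq732Background (bg454)
open BIJ85Ineq732BackgroundStab BIJ85Ineq732BackgroundRate

noncomputable section

variable {P : Params} {j : ℕ}

/-! ## §1 The argument of a unit complex number is controlled by its distance to `1` -/

/-- kernel: for `|z| = 1`, `|arg z| ≤ (π/2)·|z − 1|` (`|z − 1| = 2|sin(arg z/2)|`, Jordan's inequality `(2/π)x ≤ sin x` on `[0, π/2]`) — the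
passage from (7.3.1) `|v(∂p) − 1|` to the size of `ln v(∂p)` in the branch (2.11). [cite: BalabanImbrieJaffe1985, (7.3.1) p.326] -/
theorem abs_arg_le_of_norm_eq_one (z : ℂ) (hz : ‖z‖ = 1) : |Complex.arg z| ≤ Real.pi / 2 * ‖z - 1‖ := by
  have hz' : z = Complex.exp (Complex.I * (Complex.arg z)) := by
    have h := Complex.norm_mul_exp_arg_mul_I z
    rw [hz, Complex.ofReal_one, one_mul, mul_comm] at h
    exact h.symm
  have hn : ‖z - 1‖ = ‖2 * Real.sin (Complex.arg z / 2)‖ := by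
    conv_lhs => rw [hz']
    exact Complex.norm_exp_I_mul_ofReal_sub_one (Complex.arg z)
  rw [hn, Real.norm_eq_abs, abs_mul, abs_of_pos (by norm_num : (0 : ℝ) < 2)]
  have hπ := Real.pi_pos
  have harg := Complex.abs_arg_le_pi z
  set x := Complex.arg z with hx
  rcases le_or_gt 0 x with h0 | h0
  · have hx2 : x / 2 ≤ Real.pi / 2 := by have := (abs_le.1 harg).2; linarith
    have hj := Real.mul_le_sin (by linarith : 0 ≤ x / 2) hx2
    rw [abs_of_nonneg h0, abs_of_nonneg (Real.sin_nonneg_of_nonneg_of_le_pi (by linarith) (by linarith))]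
    have h3 : Real.pi * (2 / Real.pi * (x / 2)) = x := by field_simp
    have h4 := mul_le_mul_of_nonneg_left hj hπ.le
    rw [h3] at h4
    linarith
  · have hx2 : -x / 2 ≤ Real.pi / 2 := by have := (abs_le.1 harg).1; linarith
    have hj := Real.mul_le_sin (by linarith : 0 ≤ -x / 2) hx2
    have hs : Real.sin (x / 2) = -Real.sin (-x / 2) := by rw [neg_div, Real.sin_neg, neg_neg]
    rw [abs_of_neg h0, hs, abs_neg, abs_of_nonneg (Real.sin_nonneg_of_nonneg_of_le_pi (by linarith) (by linarith))]
    have h3 : Real.pi * (2 / Real.pi * (-x / 2)) = -x := by field_simp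
    have h4 := mul_le_mul_of_nonneg_left hj hπ.le
    rw [h3] at h4
    linarith

/-! ## §2 (4.2.4) and the use of (7.3.1) -/

/-- **(4.2.4)** `f^{(k)}(p) = (ie_k)^{−1} ln v(∂p)`, `p ∈ T₁^{(k)}`, in the branch (2.11) of the logarithm: for `|v(∂p)| = 1`, `ln v(∂p) = i·arg v(∂p)`, so
`f^{(k)}(p) = arg(v(∂p))/e_k` — a real plaquette field (`v(∂p) = plaqVar (cfg v) p`). [cite: BalabanImbrieJaffe1985, (4.2.4) p.310] -/
def fK {i : ℕ} (e : ℝ) (v : GaugeField P i U1) : Balaban1983to89.Plaq P i → ℝ :=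
  fun p => Complex.arg (plaqVar (cfg v) p) / e

/-- **(7.3.1) ⇒ `|f^{(k)}(p)| ≤ (π/2)·𝓅`**: if `|v(∂p) − 1| ≤ e·𝓅` for every plaquette and `e > 0` then `|f^{(k)}(p)| ≤ (π/2)𝓅` (`§1` at the
unit-modulus number `v(∂p)`). [cite: BalabanImbrieJaffe1985, (7.3.1) p.326] -/
theorem abs_fK_le_of_hyp731 {i : ℕ} {e calP : ℝ} (he : 0 < e) (v : GaugeField P i U1)
    (hv : ∀ p, ‖plaqVar (cfg v) p - 1‖ ≤ e * calP) (p : Balaban1983to89.Plaq P i) : |fK e v p| ≤ Real.pi / 2 * calP := by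
  have h1 : ‖plaqVar (cfg v) p‖ = 1 := by rw [plaqVar_cfg, norm_toC]
  have h2 := abs_arg_le_of_norm_eq_one _ h1
  unfold fK
  rw [abs_div, abs_of_pos he, div_le_iff₀ he]
  calc |Complex.arg (plaqVar (cfg v) p)| ≤ Real.pi / 2 * ‖plaqVar (cfg v) p - 1‖ := h2
    _ ≤ Real.pi / 2 * (e * calP) := mul_le_mul_of_nonneg_left (hv p) (by positivity)
    _ = Real.pi / 2 * calP * e := by ring

/-! ## §3 The phase of (4.5.4) for a smoothing operator `𝒪` -/

/-- **The smoothing phase of (4.5.4)**, `θ_b = −e_kη(𝒪f^{(k)})_b` with `η = L^{−k}`, for an operator `𝒪` from unit-lattice plaquette fields to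
`η`-lattice bond fields (in print `𝒪 = 𝒟_k∂^*Q^{e*}_k`). [cite: BalabanImbrieJaffe1985, (4.5.4) p.313] -/
def thetaK (k : ℕ) (e : ℝ) (O : (Balaban1983to89.Plaq P (j + k) → ℝ) → (PBond P j → ℝ)) (v : GaugeField P (j + k) U1) :
    PBond P j → ℝ :=
  fun b => -(e / (P.L : ℝ) ^ k) * O (fK e v) b

/-- **(7.3.1) + the sup-norm property of `𝒪` ⇒ the phase is `O(e_k𝓅(e_k))` on the block scale**: if `|v(∂p) − 1| ≤ e𝓅` for all `p` (`e > 0`) and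
`|(𝒪g)_b| ≤ K_D·C` whenever `|g(p)| ≤ C` for all `p`, then `L^k·|θ_b| ≤ (π/2)K_D·e·𝓅` for every `η`-bond `b`. [cite: BalabanImbrieJaffe1985, (7.3.1) p.326] -/
theorem pow_mul_abs_thetaK_le {k : ℕ} {e calP KD : ℝ} (he : 0 < e)
    {O : (Balaban1983to89.Plaq P (j + k) → ℝ) → (PBond P j → ℝ)}
    (hO : ∀ (g : Balaban1983to89.Plaq P (j + k) → ℝ) (C : ℝ), (∀ p, |g p| ≤ C) → ∀ b, |O g b| ≤ KD * C)
    (v : GaugeField P (j + k) U1) (hv : ∀ p, ‖plaqVar (cfg v) p - 1‖ ≤ e * calP) (b : PBond P j) :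
    (P.L : ℝ) ^ k * |thetaK k e O v b| ≤ Real.pi / 2 * KD * e * calP := by
  have hn : (0 : ℝ) < (P.L : ℝ) ^ k := pow_pos (Nat.cast_pos.2 P.L_pos) _
  have h1 := hO (fK e v) (Real.pi / 2 * calP) (abs_fK_le_of_hyp731 he v hv) b
  unfold thetaK
  rw [abs_mul, abs_neg, abs_div, abs_of_pos he, abs_of_pos hn]
  have e1 : (P.L : ℝ) ^ k * (e / (P.L : ℝ) ^ k * |O (fK e v) b|) = e * |O (fK e v) b| := by
    field_simp
  rw [e1]
  calc e * |O (fK e v) b| ≤ e * (KD * (Real.pi / 2 * calP)) := mul_le_mul_of_nonneg_left h1 he.le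
    _ = _ := by ring

/-! ## §4 r15's `Claim73` for the ACTUAL Sect. 7.3 data, the background computed from `v` -/

/-- Index of the ACTUAL Sect. 7.3 FAMILY at constants `K_D`, `p`: p11's `FlatIdx` (any torus of dimension `d`, levels `j`, `k ≥ 1`), a coupling
`0 < e_k ≤ 1` in the small-coupling regime `36d(2d+1)²((π/2)K_De_k𝓅(e_k))² ≤ 1`, ANY unit-lattice `U(1)` field `v`, and a smoothing operator `𝒪`
(in print `𝒟_k∂^*Q^{e*}_k`) with the located sup-norm property at constant `K_D` (p. 326: *"𝒟_k have the same properties as … G_k in [6I],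
Proposition 1.2"*).  NO hypothesis on `v`: (7.3.1) is the antecedent of `Claim73`. [cite: BalabanImbrieJaffe1985, (7.3.1)–(7.3.2) p.326] -/
structure ActIdx (d : ℕ) (KD p : ℝ) where
  base : FlatIdx d
  ek : ℝ
  hek : 0 < ek
  hek1 : ek ≤ 1
  hsmall : 36 * d * (2 * d + 1) ^ 2 * (Real.pi / 2 * KD * ek * (1 + Real.log ek⁻¹) ^ p) ^ 2 ≤ 1
  v : GaugeField base.P (base.j + base.k) U1
  O : (Balaban1983to89.Plaq base.P (base.j + base.k) → ℝ) → (PBond base.P base.j → ℝ)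
  hO : ∀ (g : Balaban1983to89.Plaq base.P (base.j + base.k) → ℝ) (C : ℝ), (∀ q, |g q| ≤ C) → ∀ b, |O g b| ≤ KD * C

namespace ActIdx

variable {d : ℕ} {KD p : ℝ}

/-- The phase `θ = −e_kη·𝒪f^{(k)}` of the index. [cite: BalabanImbrieJaffe1985, (4.5.4) p.313] -/
def theta (i : ActIdx d KD p) : PBond i.base.P i.base.j → ℝ := thetaK i.base.k i.ek i.O i.v

/-- The sup bound `T = (π/2)K_De_k𝓅(e_k)/L^k` of the phase under (7.3.1). [cite: BalabanImbrieJaffe1985, (7.3.1) p.326] -/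
def T (i : ActIdx d KD p) : ℝ := Real.pi / 2 * KD * i.ek * (1 + Real.log i.ek⁻¹) ^ p / (i.base.P.L : ℝ) ^ i.base.k

/-- kernel: `K_D ≥ 0` (the sup-norm property at `g = 1`, `C = 1`). [cite: BalabanImbrieJaffe1985, (7.2.4) p.326] -/
theorem KD_nonneg (i : ActIdx d KD p) : 0 ≤ KD := by
  have h := i.hO (fun _ => 1) 1 (fun _ => by simp) ⟨default, ⟨0, i.base.P.hd⟩⟩
  have := abs_nonneg (i.O (fun _ => 1) ⟨default, ⟨0, i.base.P.hd⟩⟩)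
  linarith

/-- kernel: `T ≥ 0`. [cite: BalabanImbrieJaffe1985, (7.3.1) p.326] -/
theorem T_nonneg (i : ActIdx d KD p) : 0 ≤ i.T := by
  have h1 : 0 ≤ 1 + Real.log i.ek⁻¹ := by
    have := Real.log_nonneg ((one_le_inv₀ i.hek).2 i.hek1); linarith
  have := i.KD_nonneg
  have hek := i.hek.le
  unfold T
  positivity

/-- kernel: `L^k·T = (π/2)K_D·e_k·𝓅(e_k)`. [cite: BalabanImbrieJaffe1985, (7.3.1) p.326] -/
theorem pow_mul_T (i : ActIdx d KD p) :
    (i.base.P.L : ℝ) ^ i.base.k * i.T = Real.pi / 2 * KD * i.ek * (1 + Real.log i.ek⁻¹) ^ p := by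
  have hn : (0 : ℝ) < (i.base.P.L : ℝ) ^ i.base.k := pow_pos (Nat.cast_pos.2 i.base.P.L_pos) _
  unfold T
  rw [mul_div_cancel₀ _ hn.ne']

/-- **Under (7.3.1) the index is an index of file 6's printed-rate family** (`BgIdxP d ((π/2)K_D) p`): `|θ_b| ≤ T`, the block-scale smallness,
and the rate `L^kT ≤ ((π/2)K_D)·e_k·𝓅(e_k)` (equality). [cite: BalabanImbrieJaffe1985, (7.3.1) p.326] -/
def toBgIdxP (i : ActIdx d KD p) (hv : ∀ q, ‖plaqVar (cfg i.v) q - 1‖ ≤ i.ek * (1 + Real.log i.ek⁻¹) ^ p) :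
    BgIdxP d (Real.pi / 2 * KD) p where
  base := i.base
  ek := i.ek
  hek := i.hek
  hek1 := i.hek1
  v := i.v
  θ := i.theta
  T := i.T
  hT := i.T_nonneg
  hθ := fun b => by
    have hn : (0 : ℝ) < (i.base.P.L : ℝ) ^ i.base.k := pow_pos (Nat.cast_pos.2 i.base.P.L_pos) _
    have h := pow_mul_abs_thetaK_le i.hek i.hO i.v hv b
    rw [← i.pow_mul_T] at h
    exact le_of_mul_le_mul_left (by simpa [ActIdx.theta] using h) hn
  hsmall := by
    rw [i.pow_mul_T]
    exact i.hsmall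
  hrate := i.pow_mul_T.le

end ActIdx

/-- `G_k(u_k)` at the background of the index (exists for every background, `exists_GK`; `Classical.choose`). [cite: BalabanImbrieJaffe1985, (4.6.2) p.313] -/
def actG {d : ℕ} {KD p : ℝ} (a : ℝ) (ha : 0 < a) (i : ActIdx d KD p) :
    FineSp i.base.P i.base.j →ₗ[ℝ] FineSp i.base.P i.base.j :=
  Classical.choose (exists_GK i.base.hk (cPhys_pos i.base.P i.base.k).ne' (i.base.aK_pos ha) (bg454 i.base.k i.v i.theta))

/-- **THE ACTUAL Sect. 7.3 DATUM of an index**: plaquettes/bonds/sites of `T₁^{(k)}`, `ψ ∈ ℓ²(T₁^{(k)})`, the HONEST `|v(∂p) − 1|`, the bond term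
`|v_bψ(b₊) − ψ(b₋)|²` (second printed form), `|ψ(x)|²`, and `⟨ψ, Δ_k(u_k)ψ⟩` AT THE BACKGROUND `u_k = Q^{s*}_kv·exp[−ie_kη𝒪f^{(k)}]` COMPUTED
FROM `v` ((4.5.4) with `𝒪` for `𝒟_k∂^*Q^{e*}_k`), printed `a_k`, physical normalization. [cite: BalabanImbrieJaffe1985, (7.3.2) p.326] -/
def actStabData {d : ℕ} {KD p : ℝ} (a : ℝ) (ha : 0 < a) (i : ActIdx d KD p) : BIJ85Sect7Statements.ScalarStabData where
  Plaq := Balaban1983to89.Plaq i.base.P (i.base.j + i.base.k)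
  Bond := PBond i.base.P (i.base.j + i.base.k)
  Site := Balaban1983to89.Site i.base.P (i.base.j + i.base.k)
  Scalar := CoarseSpK i.base.P i.base.j i.base.k
  ek := i.ek
  plaqDev := fun q => ‖plaqVar (cfg i.v) q - 1‖
  covDiffSq := fun ψ b => ‖toC (i.v b) * ψ b.tgt - ψ b.src‖ ^ 2
  absSq := fun ψ x => ‖ψ x‖ ^ 2
  deltaForm := fun ψ =>
    ⟪ψ, deltaOp (QlinK (bg454 i.base.k i.v i.theta) i.base.k) (BIJ85Sect4Statements.aK a i.base.P.L i.base.k) (actG a ha i) ψ⟫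

/-- **(7.3.1) ⇒ (7.3.2) for the actual datum**: r15's `Ineq732 γ 1 M` at `γ = min(a/(10d), ⅕)`, `M = 32γd(2d+1)²((π/2)K_D(1+2p)^p)²` FOLLOWS FROM
`Hyp731 p` (`p ≥ 0`) — (7.3.1) gives `|f^{(k)}| ≤ (π/2)𝓅(e_k)` (§2), the sup-norm property of `𝒪` gives `L^k·max|θ| ≤ (π/2)K_De_k𝓅(e_k)` (§3), and
files 5–6 give (7.3.2) at `Q^{s*}_kv·e^{iθ}` with the printed rate (`ineq732_bgStabData` at the index `(i.toBgIdxP h731).toBgIdx`, whose Sect. 7.3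
datum is this one by construction). [cite: BalabanImbrieJaffe1985, (7.3.1)–(7.3.2) p.326] -/
theorem ineq732_of_hyp731 {d : ℕ} {KD p : ℝ} (hp : 0 ≤ p) (a : ℝ) (ha : 0 < a) (i : ActIdx d KD p)
    (h731 : (actStabData a ha i).Hyp731 p) :
    (actStabData a ha i).Ineq732 (min (a / (10 * d)) (1 / 5)) 1
      (32 * min (a / (10 * d)) (1 / 5) * (d * (2 * d + 1) ^ 2 * (Real.pi / 2 * KD * (1 + 2 * p) ^ p) ^ 2)) := by
  have hv : ∀ q, ‖plaqVar (cfg i.v) q - 1‖ ≤ i.ek * (1 + Real.log i.ek⁻¹) ^ p := fun q => h731 q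
  exact ineq732_bgStabData a ha ((i.toBgIdxP hv).toBgIdx hp)

/-- kernel: the family is inhabited by an index satisfying (7.3.1) — `v = 1`, `𝒪 = 0`, `e_k = 1`, `K_D = 0` (then `𝓅(1) = 1`, the phase vanishes
and the datum is the pull-back datum of file 1) — so the implication below is not vacuous. [cite: BalabanImbrieJaffe1985, (7.3.1) p.326] -/
theorem hyp731_actual_one {d : ℕ} {p : ℝ} (a : ℝ) (ha : 0 < a) (b : FlatIdx d) :
    (actStabData a ha (⟨b, 1, one_pos, le_rfl, by simp, 1, fun _ _ => 0, fun _ _ _ _ => by simp⟩ : ActIdx d 0 p)).Hyp731 p := by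
  intro q
  have e : plaqVar (cfg (1 : GaugeField b.P (b.j + b.k) U1)) q = 1 := by
    simp [plaqVar, cfg, show ∀ c, (1 : GaugeField b.P (b.j + b.k) U1) c = 1 from fun _ => rfl, toC_one]
  show ‖plaqVar (cfg (1 : GaugeField b.P (b.j + b.k) U1)) q - 1‖ ≤ 1 * (1 + Real.log 1⁻¹) ^ p
  simp [e]

/-- **r15's typed claim of Sect. 7.3 `ScalarStabData.Claim73 𝓅 fam` — "(7.3.1) ⇒ (7.3.2) for constants γ > 0, α > 0, M < ∞" — PROVED FOR THE
FAMILY OF ACTUAL Sect. 7.3 DATA** `actStabData` over `ActIdx d K_D p` (every torus, `k ≥ 1`, small coupling `0 < e_k ≤ 1`, EVERY unit-lattice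
field `v`, the background `Q^{s*}_kv·exp[−ie_kη𝒪f^{(k)}]` COMPUTED FROM `v`, `𝒪` any operator with the sup-norm property of `𝒟_k∂^*Q^{e*}_k` at
constant `K_D`): **`γ = min(a/(10d), ⅕)`, `α = 1`, `M = 32γd(2d+1)²((π/2)K_D(1+2p)^p)²`**, the hypothesis (7.3.1) being used.  HONEST SCOPE:
the sup-norm property of the printed `𝒟_k∂^*Q^{e*}_k` ([6I] Prop. 1.2-type, row C1.Eq7.2.4's remark) is the index's located hypothesis `hO`.
[cite: BalabanImbrieJaffe1985, (7.3.1)–(7.3.2) p.326] -/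
theorem claim73_actual {d : ℕ} (hd : 0 < d) (a : ℝ) (ha : 0 < a) (KD : ℝ) {p : ℝ} (hp : 0 ≤ p) :
    BIJ85Sect7Statements.ScalarStabData.Claim73 p (actStabData (d := d) (KD := KD) (p := p) a ha) :=
  ⟨min (a / (10 * d)) (1 / 5), 1, 32 * min (a / (10 * d)) (1 / 5) * (d * (2 * d + 1) ^ 2 * (Real.pi / 2 * KD * (1 + 2 * p) ^ p) ^ 2),
    lt_min (by positivity) (by norm_num), one_pos, fun i h731 => ineq732_of_hyp731 hp a ha i h731⟩

end

end Literature.MathematicalPhysics.QuantumFieldTheory.BalabanImbrieJaffe1984to88.BIJ85Claim73Background
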